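import Summits.CriticalPhenomena.PercolationContinuityZ3.Theorems.PercNearOneGluingNoHeavyPcintThirdMemSound
import Summits.CriticalPhenomena.PercolationContinuityZ3.Theorems.PercNearOneGluingNoHeavyPcintChainMemSym
import HarnessLib

/-!
# PCINT lane, reduction B3t on the memory-`τ` DANGEROUS-SET automaton — lattice symmetry and table certificates

Cell `prim-pcint` (PAPER-2 track (iii): certified intervals for `p_c(ℤ^d)`), seat `prim-pcint-2` (gen 4); support file
(`--supports stmt-CriticalPhenomena-4575`).  Does NOT build on p205010.  Memo: `run/shared/lean/prim/pcint/REDUCTIONS.md` §B3t.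

The B3t weight `btwt` (`…ThirdMem`) is invariant under the signed permutations of the axes (`ctSet_smul`, `ctu_smul`,
`btwt_smul`, using the B3c invariance of `…ChainMemSym`), so the totals of `bthirdMemAut` are invariant
(`total_bthirdMemAut_smul`), the index automaton `bttableAut` of a table in simulation has the same totals, and a
Collatz–Wielandt table gives `p ≤ p_c^bond(ℤ^d)` (**`le_criticalProb_zd_of_thirdMemTable`**, the statement the kernel
certificates of `…ThirdMemKernelCert` discharge).
-/

noncomputable section

namespace Summit.CriticalPhenomena.PercolationContinuityZ3.Theorems.Pcint

open Finset Literature.Probability.Percolation Literature.Probability.LatticeModels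

/-! ### Lattice symmetries: equivariance of the B3t automaton -/

section SymB3t

variable {d : ℕ}

/-- **The t-sites are equivariant.** [folklore] -/
theorem ctSet_smul (kc : ℕ) (g : SPerm d) (S : MState d) (a : Fin d × Bool) :
    ctSet kc (smulState g S) (smulLetter g a) = (ctSet kc S a).image (smulSite g) := by
  classical
  have hinj : Function.Injective fun q : Site d × ℕ => (smulSite g q.1, q.2) := by
    rintro ⟨x, i⟩ ⟨y, j⟩ h
    simp only [Prod.mk.injEq] at h
    exact Prod.ext (smulSite_injective g h.1) h.2
  have key : ∀ w : Site d, (2 ≤ (bcinc (smulState g S) (smulSite g w)).card ∧ ∀ q ∈ bcinc (smulState g S) (smulSite g w), 3 ≤ q.2)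
      ↔ (2 ≤ (bcinc S w).card ∧ ∀ q ∈ bcinc S w, 3 ≤ q.2) := by
    intro w
    rw [bcinc_smul, card_image_of_injective _ hinj]
    refine and_congr Iff.rfl ⟨fun h q hq => h (smulSite g q.1, q.2) (mem_image.2 ⟨q, hq, rfl⟩), fun h q hq => ?_⟩
    obtain ⟨q', hq', rfl⟩ := mem_image.1 hq
    exact h q' hq'
  ext w
  rw [ctSet, ctSet, mem_filter, cdetSet_smul, mem_image, mem_image]
  constructor
  · rintro ⟨⟨w', hw', rfl⟩, hcond⟩
    exact ⟨w', mem_filter.2 ⟨hw', (key w').1 hcond⟩, rfl⟩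
  · rintro ⟨w', hw', rfl⟩
    obtain ⟨hD, hcond⟩ := mem_filter.1 hw'
    exact ⟨⟨w', hD, rfl⟩, (key w').2 hcond⟩

/-- **The number of `t`-units is invariant.** [folklore] -/
theorem ctu_smul (kc : ℕ) (g : SPerm d) (S : MState d) (a : Fin d × Bool) :
    ctu kc (smulState g S) (smulLetter g a) = ctu kc S a := by
  unfold ctu; rw [ctSet_smul, card_image_of_injective _ (smulSite_injective g)]

/-- **The B3t step factor is invariant.** [folklore] -/
theorem btwt_smul (q1 s tv κb : ℝ) (τ kc : ℕ) (g : SPerm d) (S : MState d) (a : Fin d × Bool) :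
    btwt q1 s tv κb τ kc (smulState g S) (smulLetter g a) = btwt q1 s tv κb τ kc S a := by
  unfold btwt; rw [bchord_smul, cdet_smul, ctu_smul, bcorner_smul]

/-- Row sums of `bthirdMemAut` against an invariant function are invariant. [folklore] -/
theorem stepSum_bthirdMemAut_smul {τ kc : ℕ} {p q1 s tv κb : ℝ} (hp : 0 ≤ p) (hq : 0 ≤ q1) (hs : 0 ≤ s) (ht : 0 ≤ tv) (hκb : 0 ≤ κb)
    (g : SPerm d) {f : MState d → ℝ} (hf : ∀ T, f (smulState g T) = f T) (S : MState d) :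
    (bthirdMemAut τ kc p q1 s tv κb hp hq hs ht hκb).stepSum f (smulState g S) =
      (bthirdMemAut τ kc p q1 s tv κb hp hq hs ht hκb).stepSum f S := by
  unfold WAut.stepSum
  rw [← Equiv.sum_comp (letterEquiv g)]
  refine Finset.sum_congr rfl fun a _ => ?_
  have h1 : (bthirdMemAut τ kc p q1 s tv κb hp hq hs ht hκb).step (smulState g S) (letterEquiv g a) =
      ((bthirdMemAut τ kc p q1 s tv κb hp hq hs ht hκb).step S a).map (smulState g) := mstep_smul τ g S a
  have h2 : (bthirdMemAut τ kc p q1 s tv κb hp hq hs ht hκb).wt (smulState g S) (letterEquiv g a) =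
      (bthirdMemAut τ kc p q1 s tv κb hp hq hs ht hκb).wt S a := by
    show p * btwt q1 s tv κb τ kc (smulState g S) (smulLetter g a) = p * btwt q1 s tv κb τ kc S a
    rw [btwt_smul]
  rw [h1, h2]
  cases (bthirdMemAut τ kc p q1 s tv κb hp hq hs ht hκb).step S a with
  | none => rfl
  | some T => simp only [Option.map_some, hf]

/-- **Totals of the B3t automaton are invariant under lattice symmetries.** [folklore] -/
theorem total_bthirdMemAut_smul {τ kc : ℕ} {p q1 s tv κb : ℝ} (hp : 0 ≤ p) (hq : 0 ≤ q1) (hs : 0 ≤ s) (ht : 0 ≤ tv) (hκb : 0 ≤ κb)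
    (g : SPerm d) : ∀ (n : ℕ) (S : MState d),
      (bthirdMemAut τ kc p q1 s tv κb hp hq hs ht hκb).total n (smulState g S) =
        (bthirdMemAut τ kc p q1 s tv κb hp hq hs ht hκb).total n S := by
  intro n
  induction n with
  | zero => intro S; rw [WAut.total_zero, WAut.total_zero]
  | succ n ih =>
    intro S
    rw [WAut.total_succ, WAut.total_succ]
    exact stepSum_bthirdMemAut_smul hp hq hs ht hκb g (fun T => ih T) S

end SymB3t

/-! ### Table certificates modulo symmetry: a finite index automaton simulating `bthirdMemAut` -/

section Table

variable {d N : ℕ}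

/-- The INDEX AUTOMATON of a bond table: states are row indices, transitions are read off the table, weights are
recomputed from the row's state. [folklore] -/
def bttableAut (τ kc : ℕ) (p q1 s tv κb : ℝ) (hp : 0 ≤ p) (hq : 0 ≤ q1) (hs : 0 ≤ s) (ht : 0 ≤ tv) (hκb : 0 ≤ κb)
    (R : Fin N → MState d) (sc : Fin N → Fin d × Bool → Option (Fin N × SPerm d)) : WAut (Fin N) (Fin d × Bool) where
  step i a := (sc i a).map Prod.fst
  wt i a := (bthirdMemAut τ kc p q1 s tv κb hp hq hs ht hκb).wt (R i) a
  wt_nonneg i a := (bthirdMemAut τ kc p q1 s tv κb hp hq hs ht hκb).wt_nonneg (R i) a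

/-- **Simulation**: the index automaton of a table in simulation with `bthirdMemAut` has the same totals. [folklore] -/
theorem total_bttableAut_eq {τ kc : ℕ} {p q1 s tv κb : ℝ} (hp : 0 ≤ p) (hq : 0 ≤ q1) (hs : 0 ≤ s) (ht : 0 ≤ tv) (hκb : 0 ≤ κb)
    (R : Fin N → MState d) (sc : Fin N → Fin d × Bool → Option (Fin N × SPerm d))
    (hsim : ∀ i a, simRel R (mstep τ (R i) a) (sc i a) = true) :
    ∀ (n : ℕ) (i : Fin N), (bttableAut τ kc p q1 s tv κb hp hq hs ht hκb R sc).total n i =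
      (bthirdMemAut τ kc p q1 s tv κb hp hq hs ht hκb).total n (R i) := by
  intro n
  induction n with
  | zero => intro i; rw [WAut.total_zero, WAut.total_zero]
  | succ n ih =>
    intro i
    rw [WAut.total_succ, WAut.total_succ]
    unfold WAut.stepSum
    refine Finset.sum_congr rfl fun a _ => ?_
    have h := hsim i a
    have e1 : (bttableAut τ kc p q1 s tv κb hp hq hs ht hκb R sc).step i a = (sc i a).map Prod.fst := rfl
    have e2 : (bthirdMemAut τ kc p q1 s tv κb hp hq hs ht hκb).step (R i) a = mstep τ (R i) a := rfl
    rw [e1, e2]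
    revert h
    generalize mstep τ (R i) a = oT
    generalize sc i a = oJ
    intro h
    cases oT with
    | none =>
      cases oJ with
      | none => rfl
      | some jg => exact absurd h (by simp [simRel])
    | some T =>
      cases oJ with
      | none => exact absurd h (by simp [simRel])
      | some jg =>
        have hT : T = smulState jg.2 (R jg.1) := by simpa [simRel] using h
        simp only [Option.map_some]
        rw [ih jg.1, hT, total_bthirdMemAut_smul]
        rfl

/-- **Table certificate ⇒ geometric bound on the totals of `bthirdMemAut`.**  If the rows carry states `R i`, positive
weights `V i ≥ 1`, successor data in simulation with `mstep`, and satisfy the Collatz–Wielandt inequalities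
`Σ_a p·btwt(R i,a)·V(succ) ≤ λ V i`, then `total n (R i) ≤ λⁿ V i` for every row. [folklore] -/
theorem total_bthirdMemAut_le_of_table {τ kc : ℕ} {p q1 s tv κb lam : ℝ} (hp : 0 ≤ p) (hq : 0 ≤ q1) (hs : 0 ≤ s) (ht : 0 ≤ tv)
    (hκb : 0 ≤ κb) (hlam : 0 ≤ lam) (R : Fin N → MState d) (sc : Fin N → Fin d × Bool → Option (Fin N × SPerm d))
    (V : Fin N → ℝ) (hV : ∀ i, 1 ≤ V i) (hsim : ∀ i a, simRel R (mstep τ (R i) a) (sc i a) = true)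
    (hcw : ∀ i, (∑ a : Fin d × Bool, match sc i a with
      | none => 0
      | some jg => p * btwt q1 s tv κb τ kc (R i) a * V jg.1) ≤ lam * V i) (n : ℕ) (i : Fin N) :
    (bthirdMemAut τ kc p q1 s tv κb hp hq hs ht hκb).total n (R i) ≤ lam ^ n * V i := by
  rw [← total_bttableAut_eq hp hq hs ht hκb R sc hsim n i]
  have hcw' : ∀ i, (bttableAut τ kc p q1 s tv κb hp hq hs ht hκb R sc).stepSum V i ≤ lam * V i := fun i => by
    refine le_of_eq_of_le ?_ (hcw i)
    unfold WAut.stepSum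
    refine Finset.sum_congr rfl fun a _ => ?_
    have e1 : (bttableAut τ kc p q1 s tv κb hp hq hs ht hκb R sc).step i a = (sc i a).map Prod.fst := rfl
    rw [e1]
    cases sc i a with
    | none => rfl
    | some jg => rfl
  have := (bttableAut τ kc p q1 s tv κb hp hq hs ht hκb R sc).total_le_of_cw one_pos hV hlam hcw' n i
  rwa [div_one] at this

/-- **Reduced-state B3t certificate (table form) ⇒ `p ≤ p_c^bond(ℤ^d)`.**  The row `i₀` with the empty state gives the bound
on the totals from `∅` needed by `le_criticalProb_zd_of_thirdMem_total`.  Constants: `1 - p² ≤ s²`, `0 < t ≤ s ≤ 1`,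
`(1-p)(1+2p) ≤ t(1+p)`, `p²(1-p) ≤ s²(s-t)`, `1 - p ≤ s t²`, `t ≤ s²`, `(1+s²)/2 ≤ κ̄`, `kc ≥ 2`, `kc + 4 ≤ τ`. [folklore] -/
theorem le_criticalProb_zd_of_thirdMemTable [NeZero d] {τ kc : ℕ} (hτ : kc + 4 ≤ τ) (hkc : 2 ≤ kc) (p : unitInterval)
    {s tv κb lam : ℝ} (hps : 1 - (p : ℝ) ^ 2 ≤ s ^ 2) (hs0 : 0 < s) (hs1 : s ≤ 1) (ht0 : 0 < tv) (hts : tv ≤ s)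
    (htp : (1 - (p : ℝ)) * (1 + 2 * p) ≤ tv * (1 + p)) (hst : (p : ℝ) ^ 2 * (1 - p) ≤ s ^ 2 * (s - tv))
    (hqt : 1 - (p : ℝ) ≤ s * tv ^ 2) (hts2 : tv ≤ s ^ 2) (hκb : (1 + s ^ 2) / 2 ≤ κb) (hlam0 : 0 ≤ lam) (hlam1 : lam < 1)
    (R : Fin N → MState d) (sc : Fin N → Fin d × Bool → Option (Fin N × SPerm d)) (V : Fin N → ℝ)
    (i₀ : Fin N) (h0 : R i₀ = ∅) (hV : ∀ i, 1 ≤ V i) (hsim : ∀ i a, simRel R (mstep τ (R i) a) (sc i a) = true)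
    (hcw : ∀ i, (∑ a : Fin d × Bool, match sc i a with
      | none => 0
      | some jg => (p : ℝ) * btwt (1 - p) s tv κb τ kc (R i) a * V jg.1) ≤ lam * V i) :
    (p : ℝ) ≤ criticalProb (zdGraph d) 0 := by
  refine le_criticalProb_zd_of_thirdMem_total hτ hkc p hps hs0 hs1 ht0 hts htp hst hqt hts2 hκb hlam0 hlam1 (C := V i₀)
    fun n => ?_
  have h := total_bthirdMemAut_le_of_table p.2.1 (sub_nonneg.2 p.2.2) hs0.le ht0.le (by nlinarith)
    hlam0 R sc V hV hsim hcw n i₀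
  rw [h0] at h
  exact h.trans_eq (mul_comm _ _)

end Table

end Summit.CriticalPhenomena.PercolationContinuityZ3.Theorems.Pcint
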